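import Literature.Analysis.ODE.LiouvilleFormula
import Literature.Analysis.FunctionSpaces.TorusAnalyticTransport
import HarnessLib

/-!
# The Jacobian of the flow of a divergence-free field on the torus is `1` (Liouville / incompressibility)

Analysis/ODE proof file (theorems only; no definitions, no named facts). For a jointly smooth
time-dependent vector field `f : ℝ × T^d → ℝ^d` and its flow written, as everywhere in the tree's
Lagrangian files, as `X(t, x) = x + proj D(t, x)` with a jointly smooth ℝ^d-valued DISPLACEMENT `D`,
`D(0, ·) = 0`, `∂ₜ D(t, x) = f(t, X(t, x))`, the Jacobian matrix is `∇X = 1 + ∇D`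
(`(∇D)_{ij} = ∂ⱼ Dᵢ`). This file proves:

* §1 **the chain rule through a torus self-map** `y ↦ y + proj E(y)`:
  `∂ⱼ (h ∘ X)(x) = Σₖ (δ_{kj} + ∂ⱼEₖ(x)) ∂ₖh(X x)` (`partialDeriv_comp_add_proj`, with the `C¹`
  statement `isContDiff_comp_add_proj` and the operator form `fderiv_comp_add_proj`);
* §2 **the variational equation, entrywise**: `∂ₜ ∂ⱼDᵢ(t,x) = Σₖ ∂ₖfᵢ(t, X(t,x)) (δ_{kj} + ∂ⱼD_k(t,x))`,
  i.e. `∂ₜ ∇X = (∇f ∘ X) ∇X` (`hasDerivAt_partialDeriv_disp`);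
* §3 **Liouville's theorem for the flow** (Majda–Bertozzi, Prop. 1.4 (ii) ⇒ (iii); Hartman Ch. IV
  Thm 1.2; Armstrong–Vicol App. A §7.3, the standing fact `det ∇X = 1` used in Prop. 7.10): the
  Jacobian `J(t,x) = det(1 + ∇D(t,x))` satisfies `∂ₜJ = (div f)(t, X) · J` (`hasDerivAt_det_flowGrad`)
  and hence **`det (1 + ∇D(t,x)) = 1` for all `t, x` when `div f ≡ 0`** (`det_flowGrad_eq_one`).

The determinant calculus is the tree's (`Calculus/LiouvilleDeterminant`: Jacobi's formula along a
curve of frames `hasDerivAt_det_rows`; `ODE/LiouvilleFormula`: the trace identity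
`sum_det_updateRow_mul_eq`); the space–time calculus is `FunctionSpaces/TorusSpaceTime`,
`TorusInverseLaplacianCalculus` (`timeDerivWithin_partialDeriv_comm`).

Consumer: the discharge of the Armstrong–Vicol App. A facts `Torus.ArmstrongVicol2025_flowGrad_comp_inv`
(Prop. 7.10: `(∇X)∘X⁻¹ = (1 + ∇Y)⁻¹ = adj(1 + ∇Y)` BECAUSE `det = 1`) and `…_flowGrad` (Prop. 7.11),
cell `ad-ideate`, analytic frame tower S1″.

## References

* A. J. Majda, A. L. Bertozzi, *Vorticity and Incompressible Flow* (CUP 2002), §1.3 Prop. 1.2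
  (`∂ₜJ = (div v)∘X · J`) and Prop. 1.4 ((ii) ⇔ (iii): incompressible ⇔ `J ≡ 1`), pp. 13–14. [`MajdaBertozziCUP2002`]
* S. Armstrong, V. Vicol, *Anomalous diffusion by fractal homogenization*, Ann. PDE 11 (2025),
  arXiv:2305.05048, App. A §7.3 (flows of divergence-free fields; Prop. 7.10). [`ArmstrongVicol2025`]
-/

noncomputable section

open Set Filter Topology Function Matrix
open scoped ContDiff

namespace Literature.Analysis.ODE

namespace TorusFlow

open Literature.Analysis.FunctionSpaces Literature.Analysis.FunctionSpaces.Torus Literature.Analysis.Calculus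

variable {d : Type*} [Fintype d] [DecidableEq d]
variable {F : Type*} [NormedAddCommGroup F] [NormedSpace ℝ F]

/-! ## §1 The chain rule through `y ↦ y + proj E(y)` -/

omit [Fintype d] [DecidableEq d] [NormedAddCommGroup F] [NormedSpace ℝ F] in
/-- The lift of `y ↦ h (y + proj E(y))` is `v ↦ (lift h)(v + lift E v)` (definitional: `proj` is
additive). [folklore] -/
private theorem lift_comp_add_proj (h : UnitAddTorus d → F) (E : UnitAddTorus d → EuclideanSpace ℝ d) :
    lift (fun y => h (y + proj (E y))) = fun v => lift h (v + lift E v) := rfl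

omit [DecidableEq d] in
/-- **`C^n` through a torus self-map**: `y ↦ h (y + proj E(y))` is `C^n` when `h` and `E` are.
[cite: MajdaBertozziCUP2002, §1.3 proof of Prop. 1.2 (p. 14)] -/
theorem isContDiff_comp_add_proj {n : WithTop ℕ∞} {h : UnitAddTorus d → F} (hh : IsContDiff n h)
    {E : UnitAddTorus d → EuclideanSpace ℝ d} (hE : IsContDiff n E) :
    IsContDiff n (fun y => h (y + proj (E y))) := by
  unfold IsContDiff at hh hE ⊢
  rw [lift_comp_add_proj]
  exact hh.comp (contDiff_id.add hE)

omit [DecidableEq d] in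
/-- Smooth version of `isContDiff_comp_add_proj`. [cite: MajdaBertozziCUP2002, §1.3 proof of Prop. 1.2 (p. 14)] -/
theorem isSmooth_comp_add_proj {h : UnitAddTorus d → F} (hh : IsSmooth h)
    {E : UnitAddTorus d → EuclideanSpace ℝ d} (hE : IsSmooth E) :
    IsSmooth (fun y => h (y + proj (E y))) :=
  isContDiff_comp_add_proj (isSmooth_iff_isContDiff.1 hh) (isSmooth_iff_isContDiff.1 hE)

omit [DecidableEq d] in
/-- **Chain rule, operator form**: `D(h ∘ X)(x) = Dh(X x) ∘ (1 + DE(x))` for `X = id + proj ∘ E`.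
[cite: MajdaBertozziCUP2002, §1.3 proof of Prop. 1.2 (p. 14)] -/
theorem fderiv_comp_add_proj {h : UnitAddTorus d → F} (hh : IsContDiff 1 h)
    {E : UnitAddTorus d → EuclideanSpace ℝ d} (hE : IsContDiff 1 E) (x : UnitAddTorus d) :
    Torus.fderiv (fun y => h (y + proj (E y))) x =
      (Torus.fderiv h (x + proj (E x))).comp (ContinuousLinearMap.id ℝ _ + Torus.fderiv E x) := by
  obtain ⟨v, rfl⟩ := proj_surjective x
  have hh1 : Differentiable ℝ (lift h) := ContDiff.differentiable hh one_ne_zero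
  have hE1 : Differentiable ℝ (lift E) := ContDiff.differentiable hE one_ne_zero
  have hcomp : HasFDerivAt (lift (fun y => h (y + proj (E y))))
      ((_root_.fderiv ℝ (lift h) (v + lift E v)).comp (ContinuousLinearMap.id ℝ _ + _root_.fderiv ℝ (lift E) v)) v := by
    rw [lift_comp_add_proj]
    exact (hh1 _).hasFDerivAt.comp v ((hasFDerivAt_id v).add (hE1 v).hasFDerivAt)
  rw [← fderiv_lift, hcomp.fderiv, fderiv_lift, fderiv_lift]
  rfl

/-- **Chain rule through a torus self-map** (`X = id + proj ∘ E`, `h` and `E` of class `C¹`):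
`∂ⱼ(h ∘ X)(x) = Σₖ (δ_{kj} + ∂ⱼE(x)ₖ) • ∂ₖh(X x)`. [cite: MajdaBertozziCUP2002, §1.3 proof of Prop. 1.2 (p. 14)] -/
theorem partialDeriv_comp_add_proj {h : UnitAddTorus d → F} (hh : IsContDiff 1 h)
    {E : UnitAddTorus d → EuclideanSpace ℝ d} (hE : IsContDiff 1 E) (j : d) (x : UnitAddTorus d) :
    partialDeriv j (fun y => h (y + proj (E y))) x =
      ∑ k, ((EuclideanSpace.single j (1 : ℝ)) k + (partialDeriv j E x) k) • partialDeriv k h (x + proj (E x)) := by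
  rw [partialDeriv_eq_fderiv_apply (isContDiff_comp_add_proj hh hE), fderiv_comp_add_proj hh hE,
    ContinuousLinearMap.comp_apply, _root_.add_apply, ContinuousLinearMap.id_apply,
    ← partialDeriv_eq_fderiv_apply hE, fderiv_apply_eq_sum_partialDeriv hh]
  rfl

/-- **Chain rule, scalar components of a vector field**: for `u : T^d → ℝ^d` of class `C¹`,
`∂ⱼ (u ∘ X)ᵢ(x) = Σₖ ∂ₖuᵢ(X x) (δ_{kj} + ∂ⱼEₖ(x))`. [cite: MajdaBertozziCUP2002, §1.3 proof of Prop. 1.2 (p. 14)] -/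
theorem partialDeriv_comp_add_proj_apply {u : UnitAddTorus d → EuclideanSpace ℝ d} (hu : IsContDiff 1 u)
    {E : UnitAddTorus d → EuclideanSpace ℝ d} (hE : IsContDiff 1 E) (i j : d) (x : UnitAddTorus d) :
    partialDeriv j (fun y => u (y + proj (E y)) i) x =
      ∑ k, partialDeriv k (fun y => u y i) (x + proj (E x)) *
        ((1 : Matrix d d ℝ) k j + partialDeriv j (fun y => E y k) x) := by
  have h1 : IsContDiff 1 (fun y => u (y + proj (E y))) := isContDiff_comp_add_proj hu hE
  rw [partialDeriv_apply_coord h1, partialDeriv_comp_add_proj hu hE]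
  simp only [WithLp.ofLp_sum, WithLp.ofLp_smul, Finset.sum_apply, Pi.smul_apply,
    smul_eq_mul, PiLp.ofLp_single, Pi.single_apply, Matrix.one_apply]
  refine Finset.sum_congr rfl fun k _ => ?_
  rw [← partialDeriv_apply_coord hu, ← partialDeriv_apply_coord hE, mul_comm]

/-! ## §2 The variational equation `∂ₜ ∇X = (∇f ∘ X) ∇X`, entrywise -/

variable {f D : ℝ → UnitAddTorus d → EuclideanSpace ℝ d}

omit [DecidableEq d] in
/-- Components of the displacement ODE: `∂ₜ Dᵢ(t, x) = fᵢ(t, X(t,x))`. [folklore] -/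
private theorem hasDerivAt_disp_apply
    (hODE : ∀ t x, HasDerivAt (fun s => D s x) (f t (x + proj (D t x))) t) (i : d) (t : ℝ)
    (x : UnitAddTorus d) : HasDerivAt (fun s => D s x i) (f t (x + proj (D t x)) i) t := by
  have h := (hODE t x).hasFDerivAt.hasFDerivWithinAt (s := Set.univ)
  have hi := (((hasFDerivWithinAt_piLp 2).1 h) i).hasDerivWithinAt
  rw [hasDerivWithinAt_univ] at hi
  simpa using hi

/-- **The variational equation of the flow, entrywise** (`X = id + proj ∘ D`, `∂ₜD = f ∘ X`,
`f, D` jointly smooth): `∂ₜ ∂ⱼDᵢ(t,x) = Σₖ ∂ₖfᵢ(t, X(t,x)) (δ_{kj} + ∂ⱼD_k(t,x))`, i.e.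
`∂ₜ∇X = (∇f ∘ X) ∇X` (time and space derivatives commute for jointly smooth fields, then the chain
rule of §1). [cite: MajdaBertozziCUP2002, §1.3 proof of Prop. 1.2 (p. 14)] -/
theorem hasDerivAt_partialDeriv_disp (hf : IsSmoothSpaceTimeOn univ f) (hD : IsSmoothSpaceTimeOn univ D)
    (hODE : ∀ t x, HasDerivAt (fun s => D s x) (f t (x + proj (D t x))) t) (i j : d) (t : ℝ)
    (x : UnitAddTorus d) :
    HasDerivAt (fun s => partialDeriv j (fun y => D s y i) x)
      (∑ k, partialDeriv k (fun y => f t y i) (x + proj (D t x)) *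
        ((1 : Matrix d d ℝ) k j + partialDeriv j (fun y => D t y k) x)) t := by
  -- work on the slab `[t-1, t+1]`
  set a : ℝ := t - 1
  set b : ℝ := t + 1
  have hab : a < b := by simp only [a, b]; linarith
  have ht : t ∈ Icc a b := ⟨by simp only [a]; linarith, by simp only [b]; linarith⟩
  have hDi : IsSmoothSpaceTimeOn (Icc a b) (fun s y => D s y i) := (hD.apply i).mono (subset_univ _)
  have hG : IsSmoothSpaceTimeOn (Icc a b) (fun s => partialDeriv j (fun y => D s y i)) :=
    hDi.partialDeriv (uniqueDiffOn_Icc hab) j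
  -- the slice derivative within the slab, upgraded to a two-sided derivative at the interior point
  have h1 : HasDerivAt (fun s => partialDeriv j (fun y => D s y i) x)
      (timeDerivWithin (Icc a b) (fun s => partialDeriv j (fun y => D s y i)) t x) t :=
    (hG.hasDerivWithinAt_slice ht x).hasDerivAt (Icc_mem_nhds (by simp only [a]; linarith) (by simp only [b]; linarith))
  -- commute `∂ₜ` and `∂ⱼ`, identify `∂ₜ Dᵢ = fᵢ ∘ X`
  have h2 : timeDerivWithin (Icc a b) (fun s => partialDeriv j (fun y => D s y i)) t x =
      partialDeriv j (timeDerivWithin (Icc a b) (fun s y => D s y i) t) x :=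
    timeDerivWithin_partialDeriv_comm hab hDi ht j x
  have h3 : timeDerivWithin (Icc a b) (fun s y => D s y i) t = fun y => f t (y + proj (D t y)) i := by
    funext y
    exact ((hasDerivAt_disp_apply hODE i t y).hasDerivWithinAt).derivWithin (uniqueDiffOn_Icc hab t ht)
  rw [h2, h3, partialDeriv_comp_add_proj_apply ((hf.isSmooth_slice (mem_univ t)).isContDiff (by simp))
    ((hD.isSmooth_slice (mem_univ t)).isContDiff (by simp))] at h1
  exact h1

/-! ## §3 Liouville's theorem: `det ∇X = 1` for divergence-free fields -/

/-- **The Jacobian ODE** `∂ₜ det ∇X(t,x) = (div f)(t, X(t,x)) · det ∇X(t,x)` for the flow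
`X = id + proj ∘ D` of a jointly smooth field `f` (Jacobi's formula along the curve of Jacobian
matrices and the variational equation). [cite: MajdaBertozziCUP2002, §1.3 Prop. 1.2 (1.15), p. 14] -/
theorem hasDerivAt_det_flowGrad (hf : IsSmoothSpaceTimeOn univ f) (hD : IsSmoothSpaceTimeOn univ D)
    (hODE : ∀ t x, HasDerivAt (fun s => D s x) (f t (x + proj (D t x))) t) (t : ℝ) (x : UnitAddTorus d) :
    HasDerivAt (fun s => (Matrix.of fun i j => (1 : Matrix d d ℝ) i j + partialDeriv j (fun y => D s y i) x).det)
      (divergence (f t) (x + proj (D t x)) *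
        (Matrix.of fun i j => (1 : Matrix d d ℝ) i j + partialDeriv j (fun y => D t y i) x).det) t := by
  set m : ℝ → d → d → ℝ := fun s i j => (1 : Matrix d d ℝ) i j + partialDeriv j (fun y => D s y i) x with hm
  set B : Matrix d d ℝ := Matrix.of fun i k => partialDeriv k (fun y => f t y i) (x + proj (D t x)) with hB
  -- the curve of Jacobian matrices and its derivative `B * m t`
  have hm' : HasDerivAt m (fun i => (B * Matrix.of (m t)) i) t := by
    refine hasDerivAt_pi.2 fun i => hasDerivAt_pi.2 fun j => ?_
    have h := (hasDerivAt_partialDeriv_disp hf hD hODE i j t x).const_add ((1 : Matrix d d ℝ) i j)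
    refine h.congr_deriv ?_
    simp only [Matrix.mul_apply, hB, Matrix.of_apply, hm]
  have hdet := hasDerivAt_det_rows hm'
  have hsum : ∑ j, (Matrix.of (update (m t) j ((B * Matrix.of (m t)) j))).det =
      (Matrix.of (m t)).det * B.trace := sum_det_updateRow_mul_eq (Matrix.of (m t)) B
  rw [hsum] at hdet
  have htr : B.trace = divergence (f t) (x + proj (D t x)) := by
    simp only [Matrix.trace, Matrix.diag_apply, hB, Matrix.of_apply, divergence]
  rw [htr, mul_comm] at hdet
  exact hdet

/-- **Liouville's theorem for the flow of a divergence-free field on the torus**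
(Majda–Bertozzi Prop. 1.4, (ii) ⇒ (iii); the standing fact `det ∇X = 1` of Armstrong–Vicol App. A
§7.3): if `f` is jointly smooth with `div f(t,·) = 0` for all `t`, and `X = id + proj ∘ D` is its flow
(`D` jointly smooth, `D(0,·) = 0`, `∂ₜD = f ∘ X`), then `det (1 + ∇D(t,x)) = 1` for all `t, x`.
[cite: MajdaBertozziCUP2002, §1.3 Prop. 1.2 and Prop. 1.4 (p. 13–14)] -/
theorem det_flowGrad_eq_one (hf : IsSmoothSpaceTimeOn univ f) (hD : IsSmoothSpaceTimeOn univ D)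
    (hD0 : ∀ x, D 0 x = 0) (hODE : ∀ t x, HasDerivAt (fun s => D s x) (f t (x + proj (D t x))) t)
    (hdiv : ∀ t, IsDivFree (f t)) (t : ℝ) (x : UnitAddTorus d) :
    (Matrix.of fun i j => (1 : Matrix d d ℝ) i j + partialDeriv j (fun y => D t y i) x).det = 1 := by
  set J : ℝ → ℝ := fun s =>
    (Matrix.of fun i j => (1 : Matrix d d ℝ) i j + partialDeriv j (fun y => D s y i) x).det with hJ
  have hJ' : ∀ s, HasDerivAt J 0 s := by
    intro s
    have h := hasDerivAt_det_flowGrad hf hD hODE s x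
    rw [hdiv s _, zero_mul] at h
    exact h
  have hconst := is_const_of_deriv_eq_zero (f := J) (fun s => (hJ' s).differentiableAt) (fun s => (hJ' s).deriv) t 0
  have hJ0 : J 0 = 1 := by
    have hzero : ∀ i j, partialDeriv j (fun y => D 0 y i) x = 0 := by
      intro i j
      rw [show (fun y => D 0 y i) = fun _ => (0 : ℝ) from funext fun y => by rw [hD0 y]; rfl]
      simp [partialDeriv, Torus.lineDeriv]
    simp only [hJ, hzero, add_zero]
    rw [show (Matrix.of fun i j => (1 : Matrix d d ℝ) i j) = 1 from rfl, Matrix.det_one]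
  show J t = 1
  rw [hconst, hJ0]

/-- **Incompressibility of the flow, inverse-matrix form**: under the hypotheses of
`det_flowGrad_eq_one`, `1 + ∇D(t,x)` is invertible and its inverse is its adjugate
(`A⁻¹ = (det A)⁻¹ adj A`, `det A = 1`) — the form in which Armstrong–Vicol read off the bound on
`(∇X)∘X⁻¹` from bounds on the entries (Prop. 7.10). [cite: ArmstrongVicol2025, App. A Prop. 7.10 (proof, p. 73)] -/
theorem inv_flowGrad_eq_adjugate (hf : IsSmoothSpaceTimeOn univ f) (hD : IsSmoothSpaceTimeOn univ D)
    (hD0 : ∀ x, D 0 x = 0) (hODE : ∀ t x, HasDerivAt (fun s => D s x) (f t (x + proj (D t x))) t)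
    (hdiv : ∀ t, IsDivFree (f t)) (t : ℝ) (x : UnitAddTorus d) :
    (Matrix.of fun i j => (1 : Matrix d d ℝ) i j + partialDeriv j (fun y => D t y i) x)⁻¹ =
      (Matrix.of fun i j => (1 : Matrix d d ℝ) i j + partialDeriv j (fun y => D t y i) x).adjugate := by
  rw [Matrix.inv_def, det_flowGrad_eq_one hf hD hD0 hODE hdiv t x, Ring.inverse_one, one_smul]

end TorusFlow

end Literature.Analysis.ODE

end
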